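import Literature.AlgebraicGeometry.Motives.ProjectiveFibreHilbertPolynomialTwists
import Literature.AlgebraicGeometry.Modules.SerreTwistMonomialSections
import Literature.Algebra.Homology.LaurentCechGlobalSectionsPerfectPairing
import HarnessLib

/-!
# The fibre dictionary, (c): the degree-`d` monomial sections span `Γ(X₀, 𝒪_{X₀}(d))` for `d ≥ B - 1`
# (Mumford, *Curves on an algebraic surface*, Lect. 14–15)

Layer `Literature/AlgebraicGeometry/Motives`, namespace `Literature.AlgebraicGeometry.Motives`.  THEOREMS ONLY (no `def`,
no instance, no notation, no named fact, no `sorry`).  Cell `hodgecm-mathlib` (D-0151), F-5 (5d-I) leaf **L-a = (δ)** «the fibre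
dictionary», head **(c)** of the seam letters (B-p19 (g16) `SEAM-La-…` 0b2cbcd7), token for token; heads (a) `Ext¹ = 0` and (b)
`h⁰ = QZ(d)` are the sibling ★ `Motives/ProjectiveFibreHilbertPolynomialTwists` (FILE 1), whose §1–§6 this file continues.
Count-neutral capital (`--supports stmt-HodgeConjecture-24835`); HC_CM is proved only modulo the 7 printed citations until rung 0
closes, and nothing here bears on it.

## The source, as printed

[Mumford1966CurvesSurface] Lecture 14, Theorem (p. 101): for an `m`-regular `F` on `ℙⁿ`, «`H⁰(F(k)) ⊗ H⁰(𝒪(1)) → H⁰(F(k+1))` is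
surjective, `k ≥ m`», whence (remark p. 102, applied to the ideal sheaf) `H⁰(𝒪_ℙ(k)) → H⁰(𝒪_X(k))` is onto for `k ≥ m - 1`; Lecture 15
(I.) (pp. 105–106): the `m₀` depends only on the Hilbert polynomial.  In the tree this is the GRADED statement (ii) of ★
`LaurentCech.regular_quot_of_hilbertPolynomial_projectiveSpace` — `H⁰(Č_d(P)) ↠ H⁰(Č_d(P⧸𝔞))` for `d ≥ B - 1`,
`B = regularityBound C(z+n,n) 0 (C(z+n,n) - QZ)` — and FILE 1 §3/§6 transport it to the sheaf: `Č_d(P⧸𝔞) ≅ Č(𝒰; 𝒪_{X₀}(d))`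
(`exists_quot_KZ_iso_cechZM`), `H⁰(Č(𝒰; 𝒪(d))) = Γ(X₀, 𝒪(d))` (`dQM_res_top_eq_zero`, the sheaf axiom), while ★
`LaurentCech.globalSectionsEquiv` reads `H⁰(Č_d(P)) = P_d`.

## Setting and statements (binders of FILE 1, verbatim)

`K` an infinite field, `ιK : X₀ ⟶ 𝐏ⁿ_K = ProjCech.PP K n` a closed immersion (`n ≥ 1`), `𝒪_{X₀}(d) := SerreTwist.twistMod ιK 𝒪_{X₀} d`,
`hQZ : ∀ m, χ(Č_m(P⧸KZ ιK)) = QZ(m)`, `hd : B - 1 ≤ d`; the unit generator `1 ∈ Γ(X₀, 𝒪(0))` spelled inline as in FILE 1.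

* §1 the section of a polynomial: `p ∈ P_d ↦ Θ_{∅,d}(p)|_{X₀} ∈ Γ(X₀, 𝒪(d))` (★ `SerreTwist.Theta` on the empty chart set, `Z_∅ = X₀`
  by `Zop_empty`) has chart pieces `p / x_j^d` (FILE 1 `comp_Theta_unitSection`, `twFun_empty_eq_map_evalRing`); for a WORD monomial
  `μ_w = Π_{t<d} x_{w t}` the piece is `Π_t x_{w t}/x_j = wordFun ιK j w`, so **the section of `μ_w` is the monomial section** ★
  `SerreTwist.monomialSection ιK d w` of ★ `Modules/SerreTwistMonomialSections` (`map_Theta_unitSection_prod_X_eq_monomialSection`,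
  by ★ `twistMod_ext` and ★ `comp_monomialSection_eq_map_wordFun`).
* §2 every homogeneous `p` of degree `d` is a combination of word monomials (Mathlib `MvPolynomial.homogeneousSubmodule_eq_finsupp_supported`).
* §3 **`exists_isHomogeneous_eq_map_Theta_of_hilbertPolynomial`**: every `t ∈ Γ(X₀, 𝒪(d))`, `d ≥ B - 1`, is the section of a homogeneous
  `p` of degree `d` (the `0`-cocycle of `t` is a cycle of `Č(𝒰; 𝒪(d))`; its class lifts along `H⁰(Č_d(P)) ↠ H⁰` (regularity (ii) and
  the iso of FILE 1); `H⁰ = Z⁰` (`C_{-1} = 0`) identifies the cycles; `globalSectionsEquiv` names the polynomial; the two sections agree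
  on every chart `Z_j` by ★ `Theta_res`), and the head **(c) `span_monomialSections_eq_top_of_hilbertPolynomial`**:
  `Submodule.span Γ(Spec K, 𝒪) (range fun w ↦ SecMod.mk (monomialSection ιK d w)) = ⊤` — the `SecMod` letter
  (scalars `Γ(Spec K, 𝒪)` through `(ιK ≫ toSpec).appTop`) of the input `hspan` of ★ `Motives/FlatFamilyGrassmannianPoint` on one fibre.

## References
* [Mumford1966CurvesSurface] D. Mumford, *Lectures on Curves on an Algebraic Surface*, Ann. of Math. Studies 59 (1966), Lecture 14
  (Theorem p. 101, p. 102), Lecture 15 (I.) (pp. 105–106).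
* [Hartshorne1977] R. Hartshorne, *Algebraic Geometry*, GTM 52 (1977), II Prop. 5.12; III Thm. 5.1 (proof, p. 225), Thm. 5.2
  (proof, p. 228).
-/
noncomputable section

set_option backward.isDefEq.respectTransparency false

open CategoryTheory CategoryTheory.Limits CategoryTheory.Abelian AlgebraicGeometry TopologicalSpace Opposite Polynomial
open Literature.Algebra.Homology Literature.Algebra.Homology.LaurentCech Literature.Algebra.Homology.OrderedCech
open Literature.AlgebraicGeometry.Morphisms Literature.AlgebraicGeometry.Morphisms.ProjCech
open Literature.AlgebraicGeometry.Modules Literature.AlgebraicGeometry.Modules.SerreTwist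

namespace Literature.AlgebraicGeometry.Motives

universe u

/-! ## §1 The section of a homogeneous polynomial and its chart formula; monomials give the monomial sections -/

section PolySection

variable {A : Type u} [CommRing A] {r : ℕ} {Z : Scheme.{u}} (ι : Z ⟶ PP A r)

/-- `toL (x_i) = x_{{i}}^1` in the Laurent ring. [folklore] -/
private theorem toL_X_eq_xs (i : Fin (r + 1)) : toL A r (MvPolynomial.X i) = xs A {i} 1 := by
  rw [← Xs_singleton, ← pow_one (Xs A {i}), toL_Xs_pow, Nat.cast_one]

/-- The word monomial `μ_w = Π_t x_{w t}` is homogeneous of degree `#w`. [folklore] -/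
private theorem isHomogeneous_prod_X {m : ℕ} (w : Fin m → Fin (r + 1)) :
    (∏ t, MvPolynomial.X (w t) : P A r).IsHomogeneous m := by
  have h := MvPolynomial.IsHomogeneous.prod Finset.univ (fun t => (MvPolynomial.X (w t) : P A r)) (fun _ => 1)
    fun t _ => MvPolynomial.isHomogeneous_X A (w t)
  simpa using h

/-- **`μ_w / x_j^m = Π_t (x_{w t} / x_j)` in `B_{{j}}`.** [folklore] -/
private theorem mk_xs_neg_mul_toL_prod_X_eq (j : Fin (r + 1)) {m : ℕ} (w : Fin m → Fin (r + 1))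
    (h : xs A {j} (-(m : ℤ)) * toL A r (∏ t, MvPolynomial.X (w t)) ∈ Bsub A r {j}) :
    (⟨xs A {j} (-(m : ℤ)) * toL A r (∏ t, MvPolynomial.X (w t)), h⟩ : Bsub A r {j}) = ∏ t, tElB A {w t} j := by
  apply Subtype.ext
  rw [SubmonoidClass.coe_finsetProd]
  change xs A {j} (-(m : ℤ)) * toL A r (∏ t, MvPolynomial.X (w t)) = ∏ t, tEl A {w t} j
  simp_rw [tEl_singleton, Finset.prod_mul_distrib, Finset.prod_const, Finset.card_univ, Fintype.card_fin,
    xs_pow, map_prod, toL_X_eq_xs]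
  rw [mul_comm]
  congr 1
  congr 1
  ring

/-- **`μ_w / x_j^m` evaluated on `Z_j` is the word chart function `wordFun ι j w`.** [cite: Hartshorne1977, II Prop. 5.12] -/
theorem evalRing_xs_neg_mul_toL_prod_X (j : Fin (r + 1)) {m : ℕ} (w : Fin m → Fin (r + 1))
    (h : xs A {j} (-(m : ℤ)) * toL A r (∏ t, MvPolynomial.X (w t)) ∈ Bsub A r {j}) :
    (evalRing ι {j} ⟨xs A {j} (-(m : ℤ)) * toL A r (∏ t, MvPolynomial.X (w t)), h⟩ : Γ(Z, Zop ι {j})) =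
      wordFun ι j w := by
  rw [mk_xs_neg_mul_toL_prod_X_eq, map_prod]
  rfl

/-- **The monomial `μ_w`, pushed through `Θ_{∅,m}` and read on `Z = Z_∅`, IS the monomial section `μ_w|_Z`**
(★ `SerreTwist.monomialSection`): both have chart pieces `μ_w / x_j^m`. [cite: Hartshorne1977, II Prop. 5.12]
[cite: Hartshorne1977, III Thm. 5.1 (proof, p. 225)] -/
theorem map_Theta_unitSection_prod_X_eq_monomialSection {m : ℕ} (w : Fin m → Fin (r + 1)) :
    (twistMod ι (unitModule Z) m).presheaf.map (homOfLE (Zop_empty ι).ge).op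
      (Theta ι (unitModule Z) 0
        (fun _ : Unit => (toTwistZero ι (unitModule Z)).app ⊤ ((1 : Γ(Z, ⊤)) : Γ(unitModule Z, ⊤))) ∅ m
        ⟨ιK A r Unit (projDeg (cdeg Unit 0) m (fun _ : Unit => ∏ t, MvPolynomial.X (w t))),
          ιK_projDeg_mem_locDeg 0 ∅ m _⟩) = monomialSection ι m w := by
  have hhom : toL A r (∏ t, MvPolynomial.X (w t)) ∈ Ldeg A r (m : ℤ) :=
    (toL_mem_Ldeg_iff _ m).2 (isHomogeneous_prod_X w)
  have hvec : ιK A r Unit (projDeg (cdeg Unit 0) (m : ℤ) (fun _ : Unit => ∏ t, MvPolynomial.X (w t))) () =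
      toL A r (∏ t, MvPolynomial.X (w t)) := by
    rw [ιK_apply, projDeg_apply]
    simp [hcomp_eq_self_of_toL_mem hhom]
  have hdeg : ((m : ℤ) - ((0 : ℕ) : ℤ)) = (m : ℤ) := by simp
  have hadm : toL A r (∏ t, MvPolynomial.X (w t)) ∈ Adm A r ∅ (m : ℤ) :=
    hdeg ▸ hvec ▸ mem_Adm_of_mem_locDeg (cdeg Unit 0) (ιK_projDeg_mem_locDeg 0 ∅ m _) ()
  refine twistMod_ext ι (unitModule Z) fun j => ?_
  rw [SerreTwist.comp_map, comp_Theta_unitSection, comp_monomialSection]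
  change Z.presheaf.map _ (twFun ι ∅ j _ _ _) = Z.presheaf.map _ (wordFun ι j w)
  rw [twFun_congr ι ∅ j _ hvec _ (hvec ▸ mem_Adm_of_mem_locDeg (cdeg Unit 0) (ιK_projDeg_mem_locDeg 0 ∅ m _) ()),
    twFun_congr_deg ι ∅ j hdeg _ _ hadm, twFun_empty_eq_map_evalRing,
    ← CategoryTheory.comp_apply, ← Functor.map_comp, ← op_comp, evalRing_xs_neg_mul_toL_prod_X]
  rfl

end PolySection

/-! ## §2 Words and monomials -/

section Words

variable {A : Type u} [CommRing A] {r : ℕ}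

/-- Every monomial of degree `m` is a word monomial `μ_w = Π_{t<m} x_{w t}` (list the variables with multiplicity).
[folklore] -/
private theorem exists_word_prod_X_eq_monomial {m : ℕ} (s : Fin (r + 1) →₀ ℕ) (hs : s.degree = m) :
    ∃ w : Fin m → Fin (r + 1), (∏ t, MvPolynomial.X (w t) : P A r) = MvPolynomial.monomial s 1 := by
  classical
  set l := s.toMultiset.toList with hl
  have hlen : l.length = m := by
    rw [hl, Multiset.length_toList, Finsupp.card_toMultiset, ← hs, Finsupp.degree_apply]
    rfl
  refine ⟨fun t => l.get (Fin.cast hlen.symm t), ?_⟩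
  have h1 : (∏ t : Fin m, MvPolynomial.X (l.get (Fin.cast hlen.symm t)) : P A r) =
      ∏ i : Fin l.length, MvPolynomial.X l[i.1] :=
    Fintype.prod_equiv (finCongr hlen.symm) _ _ fun t => by simp
  rw [h1, Fin.prod_univ_fun_getElem, ← Multiset.prod_coe, ← Multiset.map_coe, hl, Multiset.coe_toList,
    Finsupp.toMultiset_map, Finsupp.prod_toMultiset,
    Finsupp.prod_mapDomain_index (fun _ => pow_zero _) (fun _ _ _ => pow_add _ _ _), MvPolynomial.monomial_eq,
    MvPolynomial.C_1, one_mul]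

/-- A homogeneous polynomial of degree `m` is a linear combination of word monomials. [folklore] -/
private theorem mem_span_prod_X_of_isHomogeneous {m : ℕ} {p : P A r} (hp : p.IsHomogeneous m) :
    p ∈ Submodule.span A (Set.range fun w : Fin m → Fin (r + 1) => (∏ t, MvPolynomial.X (w t) : P A r)) := by
  have hmem : p ∈ MvPolynomial.homogeneousSubmodule (Fin (r + 1)) A m := hp
  rw [MvPolynomial.homogeneousSubmodule_eq_finsupp_supported, AddMonoidAlgebra.supported_eq_span_single] at hmem
  refine Submodule.span_mono ?_ hmem
  rintro _ ⟨s, hs, rfl⟩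
  obtain ⟨w, hw⟩ := exists_word_prod_X_eq_monomial (A := A) s hs
  exact ⟨w, hw.trans (MvPolynomial.single_eq_monomial s 1).symm⟩

end Words

/-! ## §3 (c): the monomial sections span `Γ(X₀, 𝒪_{X₀}(d))` for `d ≥ B - 1` -/

section Span

variable {K : Type} [Field K] [Infinite K] {n : ℕ} (hn : 1 ≤ n) {X₀ : Scheme.{0}} (ιK : X₀ ⟶ PP K n)
  [IsClosedImmersion ιK] (QZ : ℚ[X])
  (hQZ : ∀ m : ℤ, ((∑ q ∈ Finset.range (n + 1), (-1 : ℤ) ^ q *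
      (Module.finrank K ((quot (fun _ : Unit => (0 : ℤ)) (KZ ιK) m).homology q) : ℤ) : ℤ) : ℚ) = QZ.eval (m : ℚ))
  {d : ℕ} (hd : regularityBound (preHilbertPoly ℚ n 0) 0 (preHilbertPoly ℚ n 0 - QZ) - 1 ≤ (d : ℤ))

include hn hQZ hd in
/-- **Every global section of `𝒪_{X₀}(d)`, `d ≥ B - 1`, is the section of a homogeneous polynomial of degree `d`**:
`(P⧸𝔞)_d → Γ(X₀, 𝒪(d))` is onto («`H⁰(𝓘(m₀ + k)) ⊗ H⁰(𝒪(1)) → H⁰(𝓘(m₀+k+1))` is surjective … so `H⁰(𝒪_ℙ(m)) → H⁰(𝒪_Z(m))`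
is onto» from the bound on) — ★ `regular_quot_of_hilbertPolynomial_projectiveSpace` (ii) transported through
`Č_d(P⧸𝔞) ≅ Č(𝒰; 𝒪(d))` (FILE 1) and `H⁰(Č(𝒰; 𝒪(d))) = Γ` / `H⁰(Č_d(P)) = P_d` (★ `LaurentCech.globalSectionsEquiv`).
[cite: Mumford1966CurvesSurface, Lecture 14 (Theorem, p. 101) and Lecture 15 (I.) (pp. 105–106)]
[cite: Hartshorne1977, III Thm. 5.2 (proof, p. 228)] -/
theorem exists_isHomogeneous_eq_map_Theta_of_hilbertPolynomial
    (t : MSections (strZ ιK) (twistMod ιK (unitModule X₀) d) ⊤) :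
    ∃ p : P K n, p.IsHomogeneous d ∧
      t = (twistMod ιK (unitModule X₀) d).presheaf.map (homOfLE (Zop_empty ιK).ge).op
        (Theta ιK (unitModule X₀) 0
          (fun _ : Unit => (toTwistZero ιK (unitModule X₀)).app ⊤ ((1 : Γ(X₀, ⊤)) : Γ(unitModule X₀, ⊤))) ∅ d
          ⟨LaurentCech.ιK K n Unit (projDeg (cdeg Unit 0) d (fun _ : Unit => p)), ιK_projDeg_mem_locDeg 0 ∅ d _⟩) := by
  classical
  set C := cechZM ιK (unitModule X₀) 0
    (fun _ : Unit => (toTwistZero ιK (unitModule X₀)).app ⊤ ((1 : Γ(X₀, ⊤)) : Γ(unitModule X₀, ⊤)))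
    (generates_unitSection ιK) d with hC
  -- the `0`-cocycle of `t` and its cycle
  have hdt : (C.d 0 1).hom (fun σ : Simplex (Fin (n + 1)) 0 =>
      MSections.res (strZ ιK) (twistMod ιK (unitModule X₀) d) (le_top : Zop ιK σ.1 ≤ ⊤) t) = 0 := by
    have h : C.d 0 1 = ModuleCat.ofHom (dQM ιK (twistMod ιK (unitModule X₀) d) 0) := cechZM_d ιK _ 0 _ _ d 0
    rw [h]
    exact dQM_res_top_eq_zero ιK _ t
  obtain ⟨zC, hzC⟩ : ∃ z : C.cycles 0, (C.iCycles 0).hom z = fun σ : Simplex (Fin (n + 1)) 0 =>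
      MSections.res (strZ ιK) (twistMod ιK (unitModule X₀) d) (le_top : Zop ιK σ.1 ≤ ⊤) t := by
    let S : ShortComplex (ModuleCat.{0} K) := ShortComplex.mk (C.iCycles 0) (C.d 0 1) (C.iCycles_d 0 1)
    have hS : S.Exact := S.exact_of_f_is_kernel (C.cyclesIsKernel 0 1 (by simp))
    rw [ShortComplex.moduleCat_exact_iff] at hS
    exact hS _ hdt
  -- `H⁰(Č_d(P)) → H⁰(C)` is onto (regularity (ii) + the iso of FILE 1)
  obtain ⟨-, hsurj, -⟩ := regular_quot_of_hilbertPolynomial_projectiveSpace hn (KZ ιK) (isGraded_KZ ιK) hQZ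
  obtain ⟨e, he⟩ := exists_quot_KZ_iso_cechZM ιK d
  have hsurj' : Function.Surjective (HomologicalComplex.homologyMap (qHomM ιK (unitModule X₀) 0
      (fun _ : Unit => (toTwistZero ιK (unitModule X₀)).app ⊤ ((1 : Γ(X₀, ⊤)) : Γ(unitModule X₀, ⊤)))
      (generates_unitSection ιK) d) 0).hom := by
    rw [← he, HomologicalComplex.homologyMap_comp, ModuleCat.hom_comp, LinearMap.coe_comp]
    exact ((HomologicalComplex.homologyFunctor _ _ 0).mapIso e).toLinearEquiv.surjective.comp (hsurj (d : ℤ) hd)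
  obtain ⟨ξ, hξ⟩ := hsurj' ((C.homologyπ 0).hom zC)
  obtain ⟨zP, rfl⟩ := homologyπ_zero_surjective (fun _ : Unit => (0 : ℤ)) (⊤ : Submodule (P K n) (Unit → P K n)) (d : ℤ) ξ
  -- the class of `t` is the image of the cycle `zP`, hence the cycles agree (`H⁰ = Z⁰`)
  have h1 : (C.homologyπ 0).hom ((HomologicalComplex.cyclesMap (qHomM ιK (unitModule X₀) 0
      (fun _ : Unit => (toTwistZero ιK (unitModule X₀)).app ⊤ ((1 : Γ(X₀, ⊤)) : Γ(unitModule X₀, ⊤)))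
      (generates_unitSection ιK) d) 0).hom zP) = (C.homologyπ 0).hom zC := by
    rw [← hξ]
    have h := HomologicalComplex.homologyπ_naturality (qHomM ιK (unitModule X₀) 0
      (fun _ : Unit => (toTwistZero ιK (unitModule X₀)).app ⊤ ((1 : Γ(X₀, ⊤)) : Γ(unitModule X₀, ⊤)))
      (generates_unitSection ιK) d) 0
    exact (congrArg (fun φ => φ.hom zP) h).symm
  have hd0 : C.d (-1) 0 = 0 := by
    haveI := OrderedCech.isEmpty_simplex_of_neg (ι := Fin (n + 1)) (n := -1) (by norm_num)
    haveI : Subsingleton (C.X (-1)) := by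
      change Subsingleton (QXM ιK (twistMod ιK (unitModule X₀) d) (-1))
      infer_instance
    exact (ModuleCat.isZero_of_subsingleton (C.X (-1))).eq_of_src _ _
  haveI := C.isIso_homologyπ (-1) 0 (by simp) hd0
  have h2 : (HomologicalComplex.cyclesMap (qHomM ιK (unitModule X₀) 0
      (fun _ : Unit => (toTwistZero ιK (unitModule X₀)).app ⊤ ((1 : Γ(X₀, ⊤)) : Γ(unitModule X₀, ⊤)))
      (generates_unitSection ιK) d) 0).hom zP = zC :=
    (asIso (C.homologyπ 0)).toLinearEquiv.injective h1
  -- read on cochains: `t|_{Z_j} = Θ_{{j},d}(zP_j)`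
  have h3 : (fun σ : Simplex (Fin (n + 1)) 0 =>
      MSections.res (strZ ιK) (twistMod ιK (unitModule X₀) d) (le_top : Zop ιK σ.1 ≤ ⊤) t) =
      qMapM ιK (unitModule X₀) 0
        (fun _ : Unit => (toTwistZero ιK (unitModule X₀)).app ⊤ ((1 : Γ(X₀, ⊤)) : Γ(unitModule X₀, ⊤))) d 0
        (((cech (fun _ : Unit => (0 : ℤ)) (⊤ : Submodule (P K n) (Unit → P K n)) (d : ℤ)).iCycles 0).hom zP) := by
    rw [← hzC, ← h2, ← ModuleCat.comp_apply, HomologicalComplex.cyclesMap_i, ModuleCat.comp_apply]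
    rfl
  -- the polynomial
  refine ⟨(globalSectionsEquiv (A := K) hn (d : ℤ) (((cech (fun _ : Unit => (0 : ℤ))
      (⊤ : Submodule (P K n) (Unit → P K n)) (d : ℤ)).homologyπ 0).hom zP)).1, ?_, ?_⟩
  · exact (toL_mem_Ldeg_iff _ d).1 (globalSectionsEquiv (A := K) hn (d : ℤ) _).2
  set p := (globalSectionsEquiv (A := K) hn (d : ℤ) (((cech (fun _ : Unit => (0 : ℤ))
      (⊤ : Submodule (P K n) (Unit → P K n)) (d : ℤ)).homologyπ 0).hom zP)).1 with hpdef
  have hp : toL K n p ∈ Ldeg K n (d : ℤ) := (globalSectionsEquiv (A := K) hn (d : ℤ) _).2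
  have hvec : LaurentCech.ιK K n Unit (projDeg (cdeg Unit 0) (d : ℤ) (fun _ : Unit => p)) =
      fun _ => toL K n p := by
    funext u
    rw [ιK_apply, projDeg_apply]
    simp [hcomp_eq_self_of_toL_mem hp]
  refine MSections.eq_of_res_eq (strZ ιK) _ (cover ιK) (fun _ => le_top) (iSup_cover_eq_top ιK).ge fun j => ?_
  have hj := congr_fun h3 (vertex j)
  dsimp only at hj
  rw [qMapM_apply] at hj
  refine hj.trans ?_
  have hval : ((((cech (fun _ : Unit => (0 : ℤ)) (⊤ : Submodule (P K n) (Unit → P K n)) (d : ℤ)).iCycles 0).hom zP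
      (vertex j) : Unit → L K n)) = LaurentCech.ιK K n Unit (projDeg (cdeg Unit 0) (d : ℤ) (fun _ : Unit => p)) := by
    rw [hvec]
    funext u
    exact (toL_globalSectionsEquiv_homologyπ (A := K) hn (d : ℤ) zP j).symm
  refine (Theta_congr ιK (unitModule X₀) 0 _ {j} d hval _
      (locDeg_mono (cdeg Unit 0) ⊤ (d : ℤ) (Finset.empty_subset {j}) (ιK_projDeg_mem_locDeg 0 ∅ d _))).trans ?_
  refine (Theta_res ιK (unitModule X₀) 0 _ (Finset.empty_subset {j}) d _ (ιK_projDeg_mem_locDeg 0 ∅ d _)).trans ?_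
  rw [MSections.res_apply, MSections.res_apply, ← CategoryTheory.comp_apply, ← Functor.map_comp]
  rfl

omit [Infinite K] [IsClosedImmersion ιK] in
/-- Transfer of spans from the `K`-structure (`MSections`, through `K ≅ Γ(Spec K, 𝒪)`) to the `Γ(Spec K, 𝒪)`-structure
(`SecMod`): the two actions agree on `ΓSpecIso⁻¹ a`. [folklore] -/
private theorem secMod_mk_mem_span_of_mem_span (M : X₀.Modules) (S : Set (MSections (strZ ιK) M ⊤))
    {x : MSections (strZ ιK) M ⊤} (hx : x ∈ Submodule.span K S) :
    (SecMod.mk (L := M) (ρ := (ιK ≫ ProjCech.toSpec K n).appTop.hom) (U := ⊤) (show Γ(M, ⊤) from x)) ∈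
      Submodule.span Γ(Spec (CommRingCat.of K), ⊤)
        ((fun y : MSections (strZ ιK) M ⊤ =>
          SecMod.mk (L := M) (ρ := (ιK ≫ ProjCech.toSpec K n).appTop.hom) (U := ⊤) (show Γ(M, ⊤) from y)) '' S) := by
  induction hx using Submodule.span_induction with
  | mem y hy => exact Submodule.subset_span ⟨y, hy, rfl⟩
  | zero => exact Submodule.zero_mem _
  | add y z _ _ hy hz => exact Submodule.add_mem _ hy hz
  | smul a y _ hy =>
    have h : (SecMod.mk (L := M) (ρ := (ιK ≫ ProjCech.toSpec K n).appTop.hom) (U := ⊤) (show Γ(M, ⊤) from a • y)) =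
        ((Scheme.ΓSpecIso (CommRingCat.of K)).inv.hom a) •
          SecMod.mk (L := M) (ρ := (ιK ≫ ProjCech.toSpec K n).appTop.hom) (U := ⊤) (show Γ(M, ⊤) from y) := rfl
    rw [h]
    exact Submodule.smul_mem _ _ hy

include hn hQZ hd in
/-- **(c) The degree-`d` MONOMIAL SECTIONS `μ_w|_{X₀}` (★ `SerreTwist.monomialSection`) SPAN `Γ(X₀, 𝒪_{X₀}(d))` for
`d ≥ B - 1`** (scalars `Γ(Spec K, 𝒪)` through the structure map, the `SecMod` letter of the span input `hspan` of ★
`Motives/FlatFamilyGrassmannianPoint`): every section is the section of a homogeneous `p` of degree `d`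
(`exists_isHomogeneous_eq_map_Theta_of_hilbertPolynomial`), `p` is a combination of word monomials, and the section of `μ_w`
is the monomial section (`map_Theta_unitSection_prod_X_eq_monomialSection`).
[cite: Mumford1966CurvesSurface, Lecture 14 (Theorem, p. 101) and Lecture 15 (I.) (pp. 105–106)]
[cite: Hartshorne1977, II Prop. 5.12] -/
theorem span_monomialSections_eq_top_of_hilbertPolynomial :
    Submodule.span Γ(Spec (CommRingCat.of K), ⊤)
      (Set.range fun w : Fin d → Fin (n + 1) =>
        SecMod.mk (L := SerreTwist.twistMod ιK (unitModule X₀) d) (ρ := (ιK ≫ ProjCech.toSpec K n).appTop.hom) (U := ⊤)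
          (monomialSection ιK d w)) = ⊤ := by
  classical
  refine eq_top_iff.mpr fun x _ => ?_
  obtain ⟨p, hp, hx⟩ := exists_isHomogeneous_eq_map_Theta_of_hilbertPolynomial hn ιK QZ hQZ hd
    (show MSections (strZ ιK) (twistMod ιK (unitModule X₀) d) ⊤ from SecMod.val x)
  -- the `K`-linear map `p ↦ Θ_{∅,d}(p)|_{X₀}`
  let Φ : P K n →ₗ[K] MSections (strZ ιK) (twistMod ιK (unitModule X₀) d) ⊤ :=
    MSections.res (strZ ιK) (twistMod ιK (unitModule X₀) d) (Zop_empty ιK).ge ∘ₗ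
      Theta ιK (unitModule X₀) 0
        (fun _ : Unit => (toTwistZero ιK (unitModule X₀)).app ⊤ ((1 : Γ(X₀, ⊤)) : Γ(unitModule X₀, ⊤))) ∅ d ∘ₗ
      LinearMap.codRestrict (Floc K Unit 0 ∅ d)
        (LaurentCech.ιK K n Unit ∘ₗ projDeg (cdeg Unit 0) (d : ℤ) ∘ₗ LinearMap.pi fun _ : Unit => LinearMap.id)
        fun q => ιK_projDeg_mem_locDeg 0 ∅ d _
  have hΦ : ∀ q : P K n, Φ q = (twistMod ιK (unitModule X₀) d).presheaf.map (homOfLE (Zop_empty ιK).ge).op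
      (Theta ιK (unitModule X₀) 0
        (fun _ : Unit => (toTwistZero ιK (unitModule X₀)).app ⊤ ((1 : Γ(X₀, ⊤)) : Γ(unitModule X₀, ⊤))) ∅ d
        ⟨LaurentCech.ιK K n Unit (projDeg (cdeg Unit 0) d (fun _ : Unit => q)), ιK_projDeg_mem_locDeg 0 ∅ d _⟩) :=
    fun _ => rfl
  -- `val x = Φ p ∈ span_K (range monomialSection)`
  have hmem : (show MSections (strZ ιK) (twistMod ιK (unitModule X₀) d) ⊤ from SecMod.val x) ∈
      Submodule.span K (Set.range fun w : Fin d → Fin (n + 1) =>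
        (show MSections (strZ ιK) (twistMod ιK (unitModule X₀) d) ⊤ from monomialSection ιK d w)) := by
    rw [hx, ← hΦ]
    have h := Submodule.mem_map_of_mem (f := Φ) (mem_span_prod_X_of_isHomogeneous hp)
    rw [Submodule.map_span] at h
    refine Submodule.span_mono ?_ h
    rintro _ ⟨_, ⟨w, rfl⟩, rfl⟩
    exact ⟨w, (hΦ _ ▸ map_Theta_unitSection_prod_X_eq_monomialSection ιK w).symm⟩
  have h := secMod_mk_mem_span_of_mem_span ιK _ _ hmem
  rw [← Set.range_comp] at h
  exact h

end Span

end Literature.AlgebraicGeometry.Motives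

end
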